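import Summits.NavierStokesRegularity.NavierStokesRegularity.Theses.HardyPointSink
import Literature.Analysis.FluidPDE.LocalTypeILiouville
import Literature.Analysis.FluidPDE.AncientL3BackwardLiouville
import Literature.Analysis.FluidPDE.AncientWeakL3BackwardLiouvilleHolds
import Summits.NavierStokesRegularity.NavierStokesRegularity.Theorems.HardyPointSinkNoHardyTypeIAncientWeakL3Liouville
import Summits.NavierStokesRegularity.NavierStokesRegularity.Theorems.HardyPointSinkNoHardyTypeIAncientAxisymNoSwirl
import Summits.NavierStokesRegularity.NavierStokesRegularity.Theorems.HardyPointSinkNoHardyTypeIAncientSteadyL3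
import Summits.NavierStokesRegularity.NavierStokesRegularity.Theorems.HardyPointSinkNoHardyTypeIAncientSmallTypeI
import Summits.NavierStokesRegularity.NavierStokesRegularity.Theorems.HardyPointSinkNoHardyTypeIAncientSmallHardy
import Summits.NavierStokesRegularity.NavierStokesRegularity.Theorems.HardyPointSinkNoHardyTypeIAncientSelfSimilar
import Summits.NavierStokesRegularity.NavierStokesRegularity.Theorems.HardyPointSinkNoHardyTypeIAncientLargeScale
import Summits.NavierStokesRegularity.NavierStokesRegularity.Theorems.HardyPointSinkNoHardyTypeIAncientDSSTraceless
import Literature.Analysis.FluidPDE.SelfSimilar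
import Literature.Analysis.FluidPDE.GKPRigidityBackwardUniqueness

/-!
# Skeleton (line `birth` = payload slug `registered`; lead c4 v4, lead c6 v5) for the crux
# `HardyPointSink.NoHardyTypeIAncient` (stmt-NavierStokesRegularity-7980)

v5 (lead c6, 2026-08-17): composition unchanged (one sorry, `stub_hardyEnvelope` ≡ crux); added the
certificate sub-goal `hardyPointSink_cert_largeScale` (large-scale CKN ε-gap, LANDED p173423) with its
corollary `noWitness_largeScaleQuiet`, and registered the PDE-free certificate
`hardyPointSink_cert_dssTraceless` (Hardy ⇒ the λ-DSS enemy is traceless; LANDED p173863, restated below).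
v6 (lead c6, cycle 2): the traceless λ-DSS Liouville chain at the end of the file — five stubs
`hardyPointSink_tdss_*` composing (kernel-checked) into `hardyPointSink_cert_tracelessDSSLiouville`.

Line `birth` = envelope + backward-sequence Liouville. State inherited from lead c1 (skeleton sha
`72254a86…`, three registered stubs):

* `stub_albrittonBarker2019Thm41` — FACT-STUB, CLOSED (2026-08-17, lead c4): its statement, the
  Literature named fact `Literature.Analysis.FluidPDE.AlbrittonBarker2019_liouville_weakL3_backward`
  (Albritton–Barker 2019 Thm 4.1, `ε = 0`, Oseen class), is now the tree theorem
  `AlbrittonBarker2019_liouville_weakL3_backward_holds` (`AncientWeakL3BackwardLiouvilleHolds.lean`).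
* `stub_hardyEnvelope` — OPEN, load-bearing, the ONLY `sorry` of this file; UNCONDITIONALLY
  EQUIVALENT to the crux (`hardyPointSink_noHardyTypeIAncient_iff_hardyEnvelope'`, p166048).
* `stub_hardyWeakL3LiouvilleOfAB41` — LANDED p153554 as
  `Summit.NavierStokesRegularity.NavierStokesRegularity.Theorems.stub_hardyWeakL3LiouvilleOfAB41`
  (assembling the landed stubs p149059 p150605 p151452 p152110 p152895); restated here from it.

`NoHardyTypeIAncient_of : Sig.stub_hardyEnvelope → NoHardyTypeIAncient` (lead c4 form: the fact is
discharged inside) is kernel-checked with no `sorry` of its own: a hypothetical witness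
`(u, p, G)` is jointly a.e.-strongly measurable on the slab (from the weak gradient), the envelope
gives `τ_k → −∞` with weak-`L³` bounds, the landed Liouville half gives `u(t) = 0` a.e. for a.e. `t`,
and `ae_eq_zero_slab_of_ae_slice` contradicts non-triviality. The Type I bound `𝐈 < ∞` is consumed
only by the envelope.

Disproof used: none (the crux directory has no `Disproof.lean`, 2026-08-17).

Import note (tree hygiene, reported in NOTES.md): the Theorems files
`…NoHardyTypeIAncientL3SeqLiouville` (p164455) and `…NoHardyTypeIAncientPeriodicL3` (p165062) are
NOT imported here although landed: they depend on `AncientL3BackwardLiouvilleHolds` (A–B Thm 1.2),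
whose import closure declares `Literature.Analysis.FluidPDE.exists_oneScale_top_bound_of_LR` in
`AncientL3BackwardLiouvilleTools`, while the A–B Thm 4.1 discharge used for the fact-stub imports
`LocalLerayUniformTopBound`, which declares the same name — the two holds-files cannot be
co-imported. The `L³` certificate is therefore re-derived below from the weak-`L³` Liouville half
(Chebyshev), and the periodic certificate is cited, not restated.
-/

namespace Summit.NavierStokesRegularity.NavierStokesRegularity.Cruxes.NoHardyTypeIAncient.Birth

open MeasureTheory Set Function Filter TopologicalSpace
open scoped ENNReal NNReal Topology RealInnerProductSpace

open Summit.NavierStokesRegularity.NavierStokesRegularity.Theses.HardyPointSink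

/-! ### The stub statements as named propositions -/

/-- Statement of the FACT-STUB `stub_albrittonBarker2019Thm41`: literally the Literature named
fact `Literature.Analysis.FluidPDE.AlbrittonBarker2019_liouville_weakL3_backward` (Albritton–Barker
2019, Thm 4.1, `ε = 0`, final time `t₀ < 0`, bounded Oseen integral-equation class).
[cite: AlbrittonBarker2019, Thm 4.1 (arXiv:1811.00502 §4 p. 9)] -/
def Sig.stub_albrittonBarker2019Thm41 : Prop :=
  Literature.Analysis.FluidPDE.AlbrittonBarker2019_liouville_weakL3_backward

/-- Statement of `stub_hardyEnvelope` (unchanged from the birth skeleton): uniform weak-`L³` bound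
along a backward sequence of times for every Hardy-bounded Type-I bounded ancient mild solution. -/
def Sig.stub_hardyEnvelope : Prop :=
    ∀ (u : ℝ → EuclideanSpace ℝ (Fin 3) → EuclideanSpace ℝ (Fin 3))
      (p : ℝ → EuclideanSpace ℝ (Fin 3) → ℝ)
      (G : ℝ → EuclideanSpace ℝ (Fin 3) → EuclideanSpace ℝ (Fin 3) →L[ℝ] EuclideanSpace ℝ (Fin 3)),
      (∀ t < 0, AEStronglyMeasurable (u t) volume) →
      Literature.Analysis.FluidPDE.IsBoundedAncientMildSolution 1 u →
      Literature.Analysis.FluidPDE.IsSuitableWeakSolutionOn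
        (Literature.Analysis.FluidPDE.slab (EuclideanSpace ℝ (Fin 3)) (Iio 0) isOpen_Iio) 1 0 u p →
      Literature.Analysis.FluidPDE.HasWeakSpatialGradientOn
        (Literature.Analysis.FluidPDE.slab (EuclideanSpace ℝ (Fin 3)) (Iio 0) isOpen_Iio) u G →
      Literature.Analysis.FluidPDE.typeIBound
        (Iio (0 : ℝ) ×ˢ (univ : Set (EuclideanSpace ℝ (Fin 3)))) u p G < ⊤ →
      (∃ K : ℝ≥0, ∀ x₀ : EuclideanSpace ℝ (Fin 3), ∀ᵐ t ∂(volume.restrict (Iio (0 : ℝ))),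
        ∫⁻ x, ‖u t x‖ₑ ^ 2 / ‖x - x₀‖ₑ ≤ K) →
      ∃ (τ : ℕ → ℝ) (M : ℝ≥0∞), M < ⊤ ∧ Tendsto τ atTop atBot ∧ (∀ k, τ k < 0) ∧
        ∀ (k : ℕ) (s : ℝ), 0 < s →
          ENNReal.ofReal s ^ 3 * volume {x : EuclideanSpace ℝ (Fin 3) | s < ‖u (τ k) x‖} ≤ M

/-- Statement of `stub_hardyWeakL3LiouvilleOfAB41` (the Liouville half, conditional on the fact):
under A–B Thm 4.1, a Hardy-bounded duality-form bounded ancient mild solution with measurable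
slices, jointly a.e.-strongly measurable on the slab, weak-`L³`-bounded along `τ_k → −∞`, vanishes
a.e. on a.e. slice. -/
def Sig.stub_hardyWeakL3LiouvilleOfAB41 : Prop :=
    Literature.Analysis.FluidPDE.AlbrittonBarker2019_liouville_weakL3_backward →
    ∀ (u : ℝ → EuclideanSpace ℝ (Fin 3) → EuclideanSpace ℝ (Fin 3)),
      (∀ t < 0, AEStronglyMeasurable (u t) volume) →
      AEStronglyMeasurable (uncurry u)
        (volume.restrict (Iio (0 : ℝ) ×ˢ (univ : Set (EuclideanSpace ℝ (Fin 3))))) →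
      Literature.Analysis.FluidPDE.IsBoundedAncientMildSolution 1 u →
      (∃ K : ℝ≥0, ∀ x₀ : EuclideanSpace ℝ (Fin 3), ∀ᵐ t ∂(volume.restrict (Iio (0 : ℝ))),
        ∫⁻ x, ‖u t x‖ₑ ^ 2 / ‖x - x₀‖ₑ ≤ K) →
      (∃ (τ : ℕ → ℝ) (M : ℝ≥0∞), M < ⊤ ∧ Tendsto τ atTop atBot ∧ (∀ k, τ k < 0) ∧
        ∀ (k : ℕ) (s : ℝ), 0 < s →
          ENNReal.ofReal s ^ 3 * volume {x : EuclideanSpace ℝ (Fin 3) | s < ‖u (τ k) x‖} ≤ M) →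
      ∀ᵐ t ∂(volume.restrict (Iio (0 : ℝ))), u t =ᵐ[volume] 0

/-! ### The stubs (the ONLY sorry of this file is the envelope; the fact-stub is closed) -/

/-- **Fact-stub `stub_albrittonBarker2019Thm41` — CLOSED (lead c4, 2026-08-17).** Albritton–Barker
2019, Thm 4.1 (`ε = 0`, final time `t₀ < 0`, Oseen class) is now a tree THEOREM:
`Literature.Analysis.FluidPDE.AlbrittonBarker2019_liouville_weakL3_backward_holds`
(`AncientWeakL3BackwardLiouvilleHolds.lean`, discharged by the Literature debt queue while this line
ran; Theorems-side restatement `stub_albrittonBarker2019Thm41`, p166048). With it the composition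
below needs ONLY the envelope, and `NoHardyTypeIAncient ↔ Sig.stub_hardyEnvelope` holds with no
hypothesis (`hardyPointSink_noHardyTypeIAncient_iff_hardyEnvelope'`).
[cite: AlbrittonBarker2019, Thm 4.1 (arXiv:1811.00502 §4 p. 9)] -/
theorem stub_albrittonBarker2019Thm41 :
    Literature.Analysis.FluidPDE.AlbrittonBarker2019_liouville_weakL3_backward :=
  Literature.Analysis.FluidPDE.AlbrittonBarker2019_liouville_weakL3_backward_holds

/-- **Stub `stub_hardyEnvelope` (load-bearing, OPEN; held by the lead).** For every triple
`(u, p, G)` in the class of the crux — measurable slices, bounded ancient mild solution (`ν = 1`),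
suitable weak on the slab with pressure `p`, weak spatial gradient `G`, `𝐈(ℝ³ × ℝ₋) < ∞`, Hardy
bound `∫ |u(t)|²/|x − x₀| ≤ K` for every centre at a.e. time — there are negative times `τ_k → −∞`
and `M < ∞` with `s³ · vol{s < |u(τ_k)|} ≤ M` for all `s > 0`, `k`. Why it might fail / what a
proof needs: NOTES.md `## Census` and `ENVELOPE-c2-analysis.md` (the direction-dense hierarchical
multi-bump scenario; the blow-down / vanishing-final-value reformulation). -/
theorem stub_hardyEnvelope :
    ∀ (u : ℝ → EuclideanSpace ℝ (Fin 3) → EuclideanSpace ℝ (Fin 3))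
      (p : ℝ → EuclideanSpace ℝ (Fin 3) → ℝ)
      (G : ℝ → EuclideanSpace ℝ (Fin 3) → EuclideanSpace ℝ (Fin 3) →L[ℝ] EuclideanSpace ℝ (Fin 3)),
      (∀ t < 0, AEStronglyMeasurable (u t) volume) →
      Literature.Analysis.FluidPDE.IsBoundedAncientMildSolution 1 u →
      Literature.Analysis.FluidPDE.IsSuitableWeakSolutionOn
        (Literature.Analysis.FluidPDE.slab (EuclideanSpace ℝ (Fin 3)) (Iio 0) isOpen_Iio) 1 0 u p →
      Literature.Analysis.FluidPDE.HasWeakSpatialGradientOn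
        (Literature.Analysis.FluidPDE.slab (EuclideanSpace ℝ (Fin 3)) (Iio 0) isOpen_Iio) u G →
      Literature.Analysis.FluidPDE.typeIBound
        (Iio (0 : ℝ) ×ˢ (univ : Set (EuclideanSpace ℝ (Fin 3)))) u p G < ⊤ →
      (∃ K : ℝ≥0, ∀ x₀ : EuclideanSpace ℝ (Fin 3), ∀ᵐ t ∂(volume.restrict (Iio (0 : ℝ))),
        ∫⁻ x, ‖u t x‖ₑ ^ 2 / ‖x - x₀‖ₑ ≤ K) →
      ∃ (τ : ℕ → ℝ) (M : ℝ≥0∞), M < ⊤ ∧ Tendsto τ atTop atBot ∧ (∀ k, τ k < 0) ∧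
        ∀ (k : ℕ) (s : ℝ), 0 < s →
          ENNReal.ofReal s ^ 3 * volume {x : EuclideanSpace ℝ (Fin 3) | s < ‖u (τ k) x‖} ≤ M := by
  sorry

/-- **Stub `stub_hardyWeakL3LiouvilleOfAB41` (LANDED p153554 as
`Summit.NavierStokesRegularity.NavierStokesRegularity.Theorems.stub_hardyWeakL3LiouvilleOfAB41`;
restated here from it).** The Liouville half of the line, conditional on A–B Thm 4.1: Oseen
representative (`stub_hardyOseenWindow`, `stub_oseenAncientGluing`), Hardy on every slice, pinning
of the constants at `τ_k` (`stub_weakL3Pinning`), every slice in `𝔹` (`stub_hardyLargeScale`), the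
fact at every final time `t₀ < 0`. [cite: AlbrittonBarker2019, Thm 4.1 (arXiv:1811.00502 §4 p. 9)] -/
theorem stub_hardyWeakL3LiouvilleOfAB41 :
    Literature.Analysis.FluidPDE.AlbrittonBarker2019_liouville_weakL3_backward →
    ∀ (u : ℝ → EuclideanSpace ℝ (Fin 3) → EuclideanSpace ℝ (Fin 3)),
      (∀ t < 0, AEStronglyMeasurable (u t) volume) →
      AEStronglyMeasurable (uncurry u)
        (volume.restrict (Iio (0 : ℝ) ×ˢ (univ : Set (EuclideanSpace ℝ (Fin 3))))) →
      Literature.Analysis.FluidPDE.IsBoundedAncientMildSolution 1 u →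
      (∃ K : ℝ≥0, ∀ x₀ : EuclideanSpace ℝ (Fin 3), ∀ᵐ t ∂(volume.restrict (Iio (0 : ℝ))),
        ∫⁻ x, ‖u t x‖ₑ ^ 2 / ‖x - x₀‖ₑ ≤ K) →
      (∃ (τ : ℕ → ℝ) (M : ℝ≥0∞), M < ⊤ ∧ Tendsto τ atTop atBot ∧ (∀ k, τ k < 0) ∧
        ∀ (k : ℕ) (s : ℝ), 0 < s →
          ENNReal.ofReal s ^ 3 * volume {x : EuclideanSpace ℝ (Fin 3) | s < ‖u (τ k) x‖} ≤ M) →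
      ∀ᵐ t ∂(volume.restrict (Iio (0 : ℝ))), u t =ᵐ[volume] 0 :=
  Summit.NavierStokesRegularity.NavierStokesRegularity.Theorems.stub_hardyWeakL3LiouvilleOfAB41

/-! ### Composition -/

/-- **Composition (kernel-checked, no sorry of its own; lead c4 form with the fact-stub
discharged).** The ONE open stub statement — the envelope — implies the crux
`HardyPointSink.NoHardyTypeIAncient` BY NAME: Albritton–Barker 2019 Thm 4.1 is supplied by the
closed fact-stub `stub_albrittonBarker2019Thm41`, the Liouville half by the landed
`stub_hardyWeakL3LiouvilleOfAB41`. -/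
theorem NoHardyTypeIAncient_of :
    Sig.stub_hardyEnvelope →
    Summit.NavierStokesRegularity.NavierStokesRegularity.Theses.HardyPointSink.NoHardyTypeIAncient := by
  intro hEnv
  have hF : Sig.stub_albrittonBarker2019Thm41 := stub_albrittonBarker2019Thm41
  have hL : Sig.stub_hardyWeakL3LiouvilleOfAB41 := stub_hardyWeakL3LiouvilleOfAB41
  unfold Sig.stub_albrittonBarker2019Thm41 at hF
  unfold Sig.stub_hardyEnvelope at hEnv
  unfold Sig.stub_hardyWeakL3LiouvilleOfAB41 at hL
  rintro ⟨u, p, G, hmeas, hu, hsw, hG, hne, hI, hH⟩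
  -- joint measurability on the slab, from the weak spatial gradient
  have hjoint : AEStronglyMeasurable (uncurry u)
      (volume.restrict (Iio (0 : ℝ) ×ˢ (univ : Set (EuclideanSpace ℝ (Fin 3))))) :=
    hG.locallyIntegrableOn.aestronglyMeasurable
  -- the envelope: weak-L³ bound along `τ_k → -∞`
  have hE := hEnv u p G hmeas hu hsw hG hI hH
  -- the Liouville half: `u(t) = 0` a.e. for a.e. `t`
  have hslice : ∀ᵐ t ∂(volume.restrict (Iio (0 : ℝ))), u t =ᵐ[volume] 0 :=
    hL hF u hmeas hjoint hu hH hE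
  -- hence `u = 0` a.e. on the slab: contradiction
  refine hne ?_
  filter_upwards [Literature.Analysis.FluidPDE.ae_eq_zero_slab_of_ae_slice hjoint hslice] with z hz
  exact hz

/-- Kernel check (anonymous, adds no declaration): the composition instantiated with the stubs has
type the crux — so each stub's explicit signature is literally its `Sig` statement. -/
example :
    Summit.NavierStokesRegularity.NavierStokesRegularity.Theses.HardyPointSink.NoHardyTypeIAncient :=
  NoHardyTypeIAncient_of stub_hardyEnvelope

/-! ### Certificate sub-goals (lead c4): cutting down the witness class

Each `hardyPointSink_cert_*` below is a registered sub-goal, NOT a piece of the composition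
`NoHardyTypeIAncient_of`: it excludes a named subclass of hypothetical witnesses `(u, p, G)` of the
crux unconditionally (no Albritton–Barker fact), and the `noWitness_*` corollaries record, kernel-
checked, that the crux restricted to that subclass holds today. ALL SEVEN ARE LANDED (lead c4,
2026-08-17: p164103 axisymNoSwirl, p164455 L3seqLiouville, p164597 steadyL3, p164685 smallTypeI,
p164767 smallHardy, p164990 selfSimilar, p165062 periodicL3) and restated here from their
Theorems-side proofs. What survives all of them is the census of the open content: witnesses that
are not axisymmetric-without-swirl, not backward self-similar, not time-periodic (a fortiori not
steady), have `𝐈 ≥ ε₀` and Hardy constant `K ≥ K₀`, and admit no `L³`-bounded backward sequence of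
slices — e.g. the direction-dense hierarchical lattice-DSS enemy of `EnvelopeAnalysisC2.md`. -/

/-- **Certificate `hardyPointSink_cert_L3seqLiouville` (the Liouville half in `L³`,
UNCONDITIONAL; LANDED p164455 via A–B Thm 1.2, re-derived here from the weak-`L³` half + Chebyshev).** A Hardy-bounded bounded ancient mild solution (duality form, `ν = 1`) with
measurable slices, jointly a.e.-strongly measurable on the slab, whose slices are bounded in `L³`
along negative times `τ_k → −∞`, vanishes a.e. on a.e. slice: Albritton–Barker 2019 Thm 1.2 is a
tree THEOREM (`AlbrittonBarker2019_liouville_L3_backward_holds`), applied to the continuous Oseen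
representative of the line (`stub_hardyOseenWindow`, `stub_oseenAncientGluing`, Hardy on every
slice, pinning of the slice constants by the `L³` bound via Chebyshev + `stub_weakL3Pinning`).
[cite: AlbrittonBarker2019, Thm 1.2 (arXiv:1811.00502 p. 4, §4 p. 9)] -/
theorem hardyPointSink_cert_L3seqLiouville :
    ∀ (u : ℝ → EuclideanSpace ℝ (Fin 3) → EuclideanSpace ℝ (Fin 3)),
      (∀ t < 0, AEStronglyMeasurable (u t) volume) →
      AEStronglyMeasurable (uncurry u)
        (volume.restrict (Iio (0 : ℝ) ×ˢ (univ : Set (EuclideanSpace ℝ (Fin 3))))) →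
      Literature.Analysis.FluidPDE.IsBoundedAncientMildSolution 1 u →
      (∃ K : ℝ≥0, ∀ x₀ : EuclideanSpace ℝ (Fin 3), ∀ᵐ t ∂(volume.restrict (Iio (0 : ℝ))),
        ∫⁻ x, ‖u t x‖ₑ ^ 2 / ‖x - x₀‖ₑ ≤ K) →
      (∃ (τ : ℕ → ℝ) (M : ℝ≥0∞), M < ⊤ ∧ Tendsto τ atTop atBot ∧ (∀ k, τ k < 0) ∧
        ∀ k, eLpNorm (u (τ k)) 3 volume ≤ M) →
      ∀ᵐ t ∂(volume.restrict (Iio (0 : ℝ))), u t =ᵐ[volume] 0 := by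
  intro u hmeas hjoint hu hH hL3
  obtain ⟨τ, M, hM, hτ, hτneg, hbd⟩ := hL3
  refine stub_hardyWeakL3LiouvilleOfAB41 stub_albrittonBarker2019Thm41 u hmeas hjoint hu hH
    ⟨τ, M ^ 3, ENNReal.pow_lt_top hM, hτ, hτneg, fun k s hs => ?_⟩
  -- Chebyshev–Markov: the `L³` bound at `τ k` is a weak-`L³` bound
  have h := mul_meas_ge_le_pow_eLpNorm' volume (p := (3 : ℝ≥0∞)) (by norm_num) (by norm_num)
    (hmeas (τ k) (hτneg k)) (ENNReal.ofReal s)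
  have h3 : (3 : ℝ≥0∞).toReal = ((3 : ℕ) : ℝ) := by norm_num
  rw [h3, ENNReal.rpow_natCast, ENNReal.rpow_natCast] at h
  calc ENNReal.ofReal s ^ 3 * volume {x : EuclideanSpace ℝ (Fin 3) | s < ‖u (τ k) x‖}
      ≤ ENNReal.ofReal s ^ 3 *
          volume {x : EuclideanSpace ℝ (Fin 3) | ENNReal.ofReal s ≤ ‖u (τ k) x‖ₑ} := by
        refine mul_le_mul_right (measure_mono fun x hx => ?_) _
        simp only [mem_setOf_eq] at hx ⊢
        rw [← ofReal_norm]
        exact ENNReal.ofReal_le_ofReal hx.le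
    _ ≤ eLpNorm (u (τ k)) 3 volume ^ 3 := h
    _ ≤ M ^ 3 := by gcongr; exact hbd k

/-- **Certificate `hardyPointSink_cert_steadyL3` (steady fields with `𝐈 < ∞` have uniformly
`L³` slices).** If `u` is steady on `(−∞, 0)` (all slices equal), with measurable slices and
`𝐈(ℝ³ × ℝ₋) = typeIBound (Iio 0 ×ˢ univ) u p G < ∞`, then `‖u(t)‖_{L³} ≤ M < ∞` along
`τ_k = −(k+1) → −∞` (indeed at every `t`): the cubic term of `𝐈` at the cylinder `Q((0, x₀), r)`
reads `C = r⁻² · r² ∫_{B_r(x₀)} |u|³ ≤ 𝐈` by Tonelli, and `r → ∞`. (Type-I dilution; with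
`hardyPointSink_cert_L3seqLiouville` it excludes steady witnesses, `noWitness_steady`.)
[cite: AlbrittonBarker2019, §1 (display defining C and 𝐈(ω) after Thm 1.1)] -/
theorem hardyPointSink_cert_steadyL3 :
    ∀ (u : ℝ → EuclideanSpace ℝ (Fin 3) → EuclideanSpace ℝ (Fin 3))
      (p : ℝ → EuclideanSpace ℝ (Fin 3) → ℝ)
      (G : ℝ → EuclideanSpace ℝ (Fin 3) → EuclideanSpace ℝ (Fin 3) →L[ℝ] EuclideanSpace ℝ (Fin 3)),
      (∀ t < 0, AEStronglyMeasurable (u t) volume) →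
      Literature.Analysis.FluidPDE.typeIBound
        (Iio (0 : ℝ) ×ˢ (univ : Set (EuclideanSpace ℝ (Fin 3)))) u p G < ⊤ →
      (∀ s < 0, ∀ t < 0, u s = u t) →
      ∃ (τ : ℕ → ℝ) (M : ℝ≥0∞), M < ⊤ ∧ Tendsto τ atTop atBot ∧ (∀ k, τ k < 0) ∧
        ∀ k, eLpNorm (u (τ k)) 3 volume ≤ M :=
  Summit.NavierStokesRegularity.NavierStokesRegularity.Theorems.hardyPointSink_cert_steadyL3

/-- **Certificate `hardyPointSink_cert_smallTypeI` (an `ε`-gap for the Type-I quantity).**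
There is a universal `ε > 0` such that every suitable weak solution `(u, p)` of Navier–Stokes
(`ν = 1`, no force) on the slab `(−∞, 0) × ℝ³` with weak spatial gradient `G` and
`𝐈(ℝ³ × ℝ₋) = typeIBound (Iio 0 ×ˢ univ) u p G < ε` is a.e. zero on the slab: at every centre
`z₁ = (t₁, x₁)`, `t₁ < 0`, and every scale `c`, the Navier–Stokes zoom
`c u(t₁ + c² s, x₁ + c y)` is suitable in the unit ball with mean-free pressure and
`∫∫_{Q(0,1)} |u|³ + |p|^{3/2} ≲ 𝐈` (`isSuitableWeakSolutionInBall_zoom`, `eLpNorm_zoom_*_le`), so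
the one-scale CKN criterion (Lemarié-Rieusset 2016 Thm 14.4, tree theorem
`lemarieRieusset_epsilon_regularity*_holds`) bounds `|u| ≤ C₀ 𝐈^{1/3} / c` a.e. on `Q(z₁, c/2)`;
`c → ∞`. No mildness, no Hardy bound is used. (Excludes witnesses with small `𝐈`,
`noWitness_smallTypeI`.) [cite: LemarieRieusset2016, Thm. 14.4 p. 505] -/
theorem hardyPointSink_cert_smallTypeI :
    ∃ ε : ℝ≥0∞, 0 < ε ∧
    ∀ (u : ℝ → EuclideanSpace ℝ (Fin 3) → EuclideanSpace ℝ (Fin 3))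
      (p : ℝ → EuclideanSpace ℝ (Fin 3) → ℝ)
      (G : ℝ → EuclideanSpace ℝ (Fin 3) → EuclideanSpace ℝ (Fin 3) →L[ℝ] EuclideanSpace ℝ (Fin 3)),
      Literature.Analysis.FluidPDE.IsSuitableWeakSolutionOn
        (Literature.Analysis.FluidPDE.slab (EuclideanSpace ℝ (Fin 3)) (Iio 0) isOpen_Iio) 1 0 u p →
      Literature.Analysis.FluidPDE.HasWeakSpatialGradientOn
        (Literature.Analysis.FluidPDE.slab (EuclideanSpace ℝ (Fin 3)) (Iio 0) isOpen_Iio) u G →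
      Literature.Analysis.FluidPDE.typeIBound
        (Iio (0 : ℝ) ×ˢ (univ : Set (EuclideanSpace ℝ (Fin 3)))) u p G < ε →
      uncurry u =ᵐ[volume.restrict (Iio (0 : ℝ) ×ˢ (univ : Set (EuclideanSpace ℝ (Fin 3))))] 0 :=
  Summit.NavierStokesRegularity.NavierStokesRegularity.Theorems.hardyPointSink_cert_smallTypeI

/-- **Certificate `hardyPointSink_cert_smallHardy` (a gap for the Hardy constant).** There is
a universal `K₀ > 0` such that every bounded ancient mild solution (duality form, `ν = 1`) with
measurable slices, jointly a.e.-strongly measurable on the slab, Hardy-bounded about every centre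
at a.e. time with constant `K < K₀`, vanishes a.e. on a.e. slice: for the continuous Oseen
representative `U` (`stub_hardyOseenWindow`, `stub_oseenAncientGluing`, Hardy on EVERY slice) with
`M₀ = sup |U| > 0`, KNSS's quantitative smoothing (`IsKNSSDriftMild.exists_gradient_bound` via
`isKNSSDriftMild_clamp_of_oseenForward`, window of length `M₀⁻²`) gives `|∇U| ≤ C M₀²`, so
`|U(t₀, ·)| ≥ M₀/4` on `B(x₀, 1/(4 C M₀))` about a point where `|U(t₀, x₀)| > M₀/2`, whence
`∫ |U(t₀)|²/|x − x₀| ≥ |B₁|/(256 C²) =: K₀` — scale-free. No Type-I bound is used. (Excludes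
witnesses with small Hardy constant, `noWitness_smallHardy`.)
[cite: KochNadirashviliSereginSverak2009, §4 Prop. 4.1, (4.6) (arXiv:0709.3599 p. 8)] -/
theorem hardyPointSink_cert_smallHardy :
    ∃ K₀ : ℝ≥0, 0 < K₀ ∧
    ∀ (u : ℝ → EuclideanSpace ℝ (Fin 3) → EuclideanSpace ℝ (Fin 3)) (K : ℝ≥0), K < K₀ →
      (∀ t < 0, AEStronglyMeasurable (u t) volume) →
      AEStronglyMeasurable (uncurry u)
        (volume.restrict (Iio (0 : ℝ) ×ˢ (univ : Set (EuclideanSpace ℝ (Fin 3))))) →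
      Literature.Analysis.FluidPDE.IsBoundedAncientMildSolution 1 u →
      (∀ x₀ : EuclideanSpace ℝ (Fin 3), ∀ᵐ t ∂(volume.restrict (Iio (0 : ℝ))),
        ∫⁻ x, ‖u t x‖ₑ ^ 2 / ‖x - x₀‖ₑ ≤ K) →
      ∀ᵐ t ∂(volume.restrict (Iio (0 : ℝ))), u t =ᵐ[volume] 0 :=
  Summit.NavierStokesRegularity.NavierStokesRegularity.Theorems.hardyPointSink_cert_smallHardy

/-- **Certificate `hardyPointSink_cert_axisymNoSwirl` (axisymmetric witnesses without swirl
are excluded; lead c4, proved).** No triple of the crux class has axisymmetric, swirl-free slices: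
KNSS 2009 Thm 5.2 in the duality-form class (tree theorem `knss_axisymmetric_no_swirl'_holds`)
makes every slice a.e. constant, and a field with `𝐈 < ∞` that is not a.e. zero is not slice-wise
a.e. constant (`not_ae_slice_const_of_abTypeIBound`). The Hardy bound is not even used.
[cite: KochNadirashviliSereginSverak2009, Thm 5.2 (arXiv pp. 9–10)] -/
theorem hardyPointSink_cert_axisymNoSwirl :
    ∀ (u : ℝ → EuclideanSpace ℝ (Fin 3) → EuclideanSpace ℝ (Fin 3))
      (p : ℝ → EuclideanSpace ℝ (Fin 3) → ℝ)
      (G : ℝ → EuclideanSpace ℝ (Fin 3) → EuclideanSpace ℝ (Fin 3) →L[ℝ] EuclideanSpace ℝ (Fin 3)),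
      (∀ t < 0, AEStronglyMeasurable (u t) volume) →
      Literature.Analysis.FluidPDE.IsBoundedAncientMildSolution 1 u →
      Literature.Analysis.FluidPDE.HasWeakSpatialGradientOn
        (Literature.Analysis.FluidPDE.slab (EuclideanSpace ℝ (Fin 3)) (Iio 0) isOpen_Iio) u G →
      ¬ (uncurry u =ᵐ[volume.restrict
        (Iio (0 : ℝ) ×ˢ (univ : Set (EuclideanSpace ℝ (Fin 3))))] 0) →
      Literature.Analysis.FluidPDE.typeIBound
        (Iio (0 : ℝ) ×ˢ (univ : Set (EuclideanSpace ℝ (Fin 3)))) u p G < ⊤ →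
      (∀ t < 0, Literature.Analysis.FluidPDE.IsAxisymmetric (u t)) →
      (∀ t < 0, Literature.Analysis.FluidPDE.HasNoSwirl (u t)) → False :=
  Summit.NavierStokesRegularity.NavierStokesRegularity.Theorems.hardyPointSink_cert_axisymNoSwirl

/-- **Certificate `hardyPointSink_cert_selfSimilar` (LANDED p164990): no backward self-similar
witness.** A triple of the crux class whose velocity is `lerayBackward a T U` on `t < 0` for a Leray
profile `(U, P)` (`IsLerayProfile 1 a U P`, `a > 0`, any blow-up time `T`) does not exist: the
class bound makes `U` bounded, Tsai 1998 Thm 1 (`q = ∞`, tree theorem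
`tsai_selfsimilar_bounded_holds`) makes it constant, and constant slices contradict `𝐈 < ∞`
(`not_ae_slice_const_of_abTypeIBound`). [cite: Tsai1998, Thm 1 (p. 31)] -/
theorem hardyPointSink_cert_selfSimilar :
    ∀ (u : ℝ → EuclideanSpace ℝ (Fin 3) → EuclideanSpace ℝ (Fin 3))
      (p : ℝ → EuclideanSpace ℝ (Fin 3) → ℝ)
      (G : ℝ → EuclideanSpace ℝ (Fin 3) → EuclideanSpace ℝ (Fin 3) →L[ℝ] EuclideanSpace ℝ (Fin 3)),
      Literature.Analysis.FluidPDE.HasWeakSpatialGradientOn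
        (Literature.Analysis.FluidPDE.slab (EuclideanSpace ℝ (Fin 3)) (Iio 0) isOpen_Iio) u G →
      ¬ (uncurry u =ᵐ[volume.restrict
        (Iio (0 : ℝ) ×ˢ (univ : Set (EuclideanSpace ℝ (Fin 3))))] 0) →
      Literature.Analysis.FluidPDE.typeIBound
        (Iio (0 : ℝ) ×ˢ (univ : Set (EuclideanSpace ℝ (Fin 3)))) u p G < ⊤ →
      Literature.Analysis.FluidPDE.IsBoundedAncientMildSolution 1 u →
      (∃ (a T : ℝ) (U : EuclideanSpace ℝ (Fin 3) → EuclideanSpace ℝ (Fin 3))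
          (P : EuclideanSpace ℝ (Fin 3) → ℝ),
        0 < a ∧ Literature.Analysis.FluidPDE.IsLerayProfile 1 a U P ∧
        ∀ t < 0, u t = Literature.Analysis.FluidPDE.lerayBackward a T U t) → False :=
  Summit.NavierStokesRegularity.NavierStokesRegularity.Theorems.hardyPointSink_cert_selfSimilar

/- **Certificate `hardyPointSink_cert_periodicL3` (LANDED p165062, Theorems file
`HardyPointSinkNoHardyTypeIAncientPeriodicL3.lean`, with the corollary
`hardyPointSink_noHardyTypeIAncient_periodic`: NO time-periodic witness): time-periodic fields with
`𝐈 < ∞` have an `L³`-bounded backward sequence of slices. Cited, not restated (import note in the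
module docstring). -/

/-- **Certificate `hardyPointSink_cert_largeScale` (the LARGE-SCALE `ε`-gap; lead c6, LANDED
p173423).** There is a universal `ε > 0` such that every suitable weak solution `(u, p)` on the slab
with weak gradient `G` and `𝐈 < ∞`, for which at some spatial centre `x₁` and EVERY final time
`t₁ < 0` the one-scale quantity `C(Q((t₁,x₁),c)) + D_osc(Q((t₁,x₁),c))` is `< ε` for arbitrarily
large radii `c`, is a.e. zero: the one-scale CKN criterion at large top-touching cylinders (exact
covariance `cknC_nsZoom`, `cknDOsc_nsZoom` of the zoom lemmas of `cert_smallTypeI`) and exhaustion.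
Contrapositive (`hardyPointSink_cert_largeScale_witness`, `…_abScaledSum` in the Theorems file): a
witness is `ε`-singular at spatial infinity about every centre — the limit-free form of "every
blow-down of a witness is non-trivial", first step of the crux ideas `blowdown-cone` (S1) and
`exposed-halfspace` (G3). No mildness, no Hardy bound is used. [cite: Seregin2020, Prop. 1.4 (1)] -/
theorem hardyPointSink_cert_largeScale :
    ∃ ε : ℝ≥0∞, 0 < ε ∧
    ∀ (u : ℝ → EuclideanSpace ℝ (Fin 3) → EuclideanSpace ℝ (Fin 3))
      (p : ℝ → EuclideanSpace ℝ (Fin 3) → ℝ)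
      (G : ℝ → EuclideanSpace ℝ (Fin 3) → EuclideanSpace ℝ (Fin 3) →L[ℝ] EuclideanSpace ℝ (Fin 3)),
      Literature.Analysis.FluidPDE.IsSuitableWeakSolutionOn
        (Literature.Analysis.FluidPDE.slab (EuclideanSpace ℝ (Fin 3)) (Iio 0) isOpen_Iio) 1 0 u p →
      Literature.Analysis.FluidPDE.HasWeakSpatialGradientOn
        (Literature.Analysis.FluidPDE.slab (EuclideanSpace ℝ (Fin 3)) (Iio 0) isOpen_Iio) u G →
      Literature.Analysis.FluidPDE.typeIBound
        (Iio (0 : ℝ) ×ˢ (univ : Set (EuclideanSpace ℝ (Fin 3)))) u p G < ⊤ →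
      ∀ x₁ : EuclideanSpace ℝ (Fin 3),
        (∀ t₁ : ℝ, t₁ < 0 → ∃ᶠ c in atTop,
          Literature.Analysis.FluidPDE.cknC c (t₁, x₁) u +
            Literature.Analysis.FluidPDE.cknDOsc c (t₁, x₁) p < ε) →
      uncurry u =ᵐ[volume.restrict (Iio (0 : ℝ) ×ˢ (univ : Set (EuclideanSpace ℝ (Fin 3))))] 0 :=
  Summit.NavierStokesRegularity.NavierStokesRegularity.Theorems.hardyPointSink_cert_largeScale

/-- **Certificate `hardyPointSink_cert_dssTraceless` (Hardy makes the λ-DSS enemy TRACELESS; lead c6,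
PDE-free, LANDED p173863).** If the slices of `u` are measurable for `t < 0` and Hardy-bounded about `x₀`
at a.e. `t < 0`, and `u` extends (`v = u` on `t < 0`) to a field `v` which is `λ`-discretely
self-similar about `(x₀, T)`, `T > 0`, `λ > 1` (`v(T − s/λ^{2j}, x₀ + λ^{-j}y) = λ^j v(T − s, x₀ + y)`,
`s > 0`, `j ∈ ℕ`), then for some `t₀ < 0` and every `ρ > 0` the `L²`-mass of `v` in `B(x₀, ρ)` tends to
`0` along the DSS times `t_j = T − (T − t₀)/λ^{2j} ↑ T`: Hardy at ONE slice makes `R⁻¹∫_{B(x₀,R)}|u(t₀)|²`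
vanish as `R → ∞`, and covariance (`scaledL2_nsZoom`) maps `B(x₀,ρ)` at time `t_j` onto `B(x₀, λ^jρ)`
at time `t₀` with the factor `ρ (λ^jρ)⁻¹`. So the planner's named enemy (a backward λ-DSS blow-up, any
`λ`) is, under the Hardy clause, a blow-up with identically vanishing final-time `L²_loc` trace; the open
content behind it is backward uniqueness across a traceless Type-I singular time. [folklore] -/
theorem hardyPointSink_cert_dssTraceless :
    ∀ (u v : ℝ → EuclideanSpace ℝ (Fin 3) → EuclideanSpace ℝ (Fin 3)) (x₀ : EuclideanSpace ℝ (Fin 3))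
      (K : ℝ≥0) (T lam : ℝ), 0 < T → 1 < lam → (∀ t < 0, AEStronglyMeasurable (u t) volume) →
      (∀ᵐ t ∂(volume.restrict (Iio (0 : ℝ))), ∫⁻ x, ‖u t x‖ₑ ^ 2 / ‖x - x₀‖ₑ ≤ K) →
      (∀ t < 0, v t = u t) →
      (∀ (j : ℕ) (y : EuclideanSpace ℝ (Fin 3)) (s : ℝ), 0 < s →
        v (T - s / lam ^ (2 * j)) (x₀ + (lam ^ j)⁻¹ • y) = lam ^ j • v (T - s) (x₀ + y)) →
      ∃ t₀ : ℝ, t₀ < 0 ∧ ∀ ρ : ℝ, 0 < ρ →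
        Tendsto (fun j : ℕ => ∫⁻ y in Metric.ball (0 : EuclideanSpace ℝ (Fin 3)) ρ,
          ‖v (T - (T - t₀) / lam ^ (2 * j)) (x₀ + y)‖ₑ ^ 2) atTop (𝓝 0) :=
  Summit.NavierStokesRegularity.NavierStokesRegularity.Theorems.hardyPointSink_cert_dssTraceless

/-! ### Corollaries: the crux restricted to each excluded subclass (kernel-checked compositions) -/

/-- The witness predicate of the crux (its negand, unfolded), as a local abbreviation for the
corollaries below. -/
def IsWitness (u : ℝ → EuclideanSpace ℝ (Fin 3) → EuclideanSpace ℝ (Fin 3))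
    (p : ℝ → EuclideanSpace ℝ (Fin 3) → ℝ)
    (G : ℝ → EuclideanSpace ℝ (Fin 3) → EuclideanSpace ℝ (Fin 3) →L[ℝ] EuclideanSpace ℝ (Fin 3)) :
    Prop :=
  (∀ t < 0, AEStronglyMeasurable (u t) volume) ∧
  Literature.Analysis.FluidPDE.IsBoundedAncientMildSolution 1 u ∧
  Literature.Analysis.FluidPDE.IsSuitableWeakSolutionOn
    (Literature.Analysis.FluidPDE.slab (EuclideanSpace ℝ (Fin 3)) (Iio 0) isOpen_Iio) 1 0 u p ∧
  Literature.Analysis.FluidPDE.HasWeakSpatialGradientOn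
    (Literature.Analysis.FluidPDE.slab (EuclideanSpace ℝ (Fin 3)) (Iio 0) isOpen_Iio) u G ∧
  ¬ (uncurry u =ᵐ[volume.restrict
    (Iio (0 : ℝ) ×ˢ (univ : Set (EuclideanSpace ℝ (Fin 3))))] 0) ∧
  Literature.Analysis.FluidPDE.typeIBound
    (Iio (0 : ℝ) ×ˢ (univ : Set (EuclideanSpace ℝ (Fin 3)))) u p G < ⊤ ∧
  ∃ K : ℝ≥0, ∀ x₀ : EuclideanSpace ℝ (Fin 3), ∀ᵐ t ∂(volume.restrict (Iio (0 : ℝ))),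
    ∫⁻ x, ‖u t x‖ₑ ^ 2 / ‖x - x₀‖ₑ ≤ K

/-- Sanity: the crux is literally "no witness". -/
theorem noHardyTypeIAncient_iff_forall_not_isWitness :
    Summit.NavierStokesRegularity.NavierStokesRegularity.Theses.HardyPointSink.NoHardyTypeIAncient ↔
      ∀ u p G, ¬ IsWitness u p G := by
  unfold Summit.NavierStokesRegularity.NavierStokesRegularity.Theses.HardyPointSink.NoHardyTypeIAncient
    IsWitness
  constructor
  · intro h u p G hw
    exact h ⟨u, p, G, hw⟩
  · rintro h ⟨u, p, G, hw⟩
    exact h u p G hw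

/-- **No witness with an `L³`-bounded backward sequence of slices** (from
`hardyPointSink_cert_L3seqLiouville`). -/
theorem noWitness_L3seq (u p G) (hw : IsWitness u p G)
    (hL3 : ∃ (τ : ℕ → ℝ) (M : ℝ≥0∞), M < ⊤ ∧ Tendsto τ atTop atBot ∧ (∀ k, τ k < 0) ∧
      ∀ k, eLpNorm (u (τ k)) 3 volume ≤ M) : False := by
  obtain ⟨hmeas, hu, -, hG, hne, -, hH⟩ := hw
  have hjoint : AEStronglyMeasurable (uncurry u)
      (volume.restrict (Iio (0 : ℝ) ×ˢ (univ : Set (EuclideanSpace ℝ (Fin 3))))) :=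
    hG.locallyIntegrableOn.aestronglyMeasurable
  refine hne ?_
  filter_upwards [Literature.Analysis.FluidPDE.ae_eq_zero_slab_of_ae_slice hjoint
    (hardyPointSink_cert_L3seqLiouville u hmeas hjoint hu hH hL3)] with z hz
  exact hz

/-- **No steady witness** (from `hardyPointSink_cert_steadyL3` and `noWitness_L3seq`). -/
theorem noWitness_steady (u p G) (hw : IsWitness u p G) (hst : ∀ s < 0, ∀ t < 0, u s = u t) :
    False :=
  noWitness_L3seq u p G hw (hardyPointSink_cert_steadyL3 u p G hw.1 hw.2.2.2.2.2.1 hst)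

/-- **No witness with small Type-I quantity** (from `hardyPointSink_cert_smallTypeI`). -/
theorem noWitness_smallTypeI : ∃ ε : ℝ≥0∞, 0 < ε ∧ ∀ u p G, IsWitness u p G →
    Literature.Analysis.FluidPDE.typeIBound
      (Iio (0 : ℝ) ×ˢ (univ : Set (EuclideanSpace ℝ (Fin 3)))) u p G < ε → False := by
  obtain ⟨ε, hε, h⟩ := hardyPointSink_cert_smallTypeI
  refine ⟨ε, hε, fun u p G hw hI => ?_⟩
  obtain ⟨-, -, hsw, hG, hne, -, -⟩ := hw
  exact hne (h u p G hsw hG hI)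

/-- **No witness with small Hardy constant** (from `hardyPointSink_cert_smallHardy`). -/
theorem noWitness_smallHardy : ∃ K₀ : ℝ≥0, 0 < K₀ ∧ ∀ u p G, IsWitness u p G → ∀ K : ℝ≥0, K < K₀ →
    (∀ x₀ : EuclideanSpace ℝ (Fin 3), ∀ᵐ t ∂(volume.restrict (Iio (0 : ℝ))),
      ∫⁻ x, ‖u t x‖ₑ ^ 2 / ‖x - x₀‖ₑ ≤ K) → False := by
  obtain ⟨K₀, hK₀, h⟩ := hardyPointSink_cert_smallHardy
  refine ⟨K₀, hK₀, fun u p G hw K hK hHK => ?_⟩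
  obtain ⟨hmeas, hu, -, hG, hne, -, -⟩ := hw
  have hjoint : AEStronglyMeasurable (uncurry u)
      (volume.restrict (Iio (0 : ℝ) ×ˢ (univ : Set (EuclideanSpace ℝ (Fin 3))))) :=
    hG.locallyIntegrableOn.aestronglyMeasurable
  refine hne ?_
  filter_upwards [Literature.Analysis.FluidPDE.ae_eq_zero_slab_of_ae_slice hjoint
    (h u K hK hmeas hjoint hu hHK)] with z hz
  exact hz

/-- **No axisymmetric swirl-free witness** (from `hardyPointSink_cert_axisymNoSwirl`). -/
theorem noWitness_axisymNoSwirl (u p G) (hw : IsWitness u p G)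
    (haxi : ∀ t < 0, Literature.Analysis.FluidPDE.IsAxisymmetric (u t))
    (hsw : ∀ t < 0, Literature.Analysis.FluidPDE.HasNoSwirl (u t)) : False :=
  hardyPointSink_cert_axisymNoSwirl u p G hw.1 hw.2.1 hw.2.2.2.1 hw.2.2.2.2.1 hw.2.2.2.2.2.1 haxi hsw

/-- **No backward self-similar witness** (from `hardyPointSink_cert_selfSimilar`). -/
theorem noWitness_selfSimilar (u p G) (hw : IsWitness u p G)
    (hss : ∃ (a T : ℝ) (U : EuclideanSpace ℝ (Fin 3) → EuclideanSpace ℝ (Fin 3))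
        (P : EuclideanSpace ℝ (Fin 3) → ℝ),
      0 < a ∧ Literature.Analysis.FluidPDE.IsLerayProfile 1 a U P ∧
      ∀ t < 0, u t = Literature.Analysis.FluidPDE.lerayBackward a T U t) : False :=
  hardyPointSink_cert_selfSimilar u p G hw.2.2.2.1 hw.2.2.2.2.1 hw.2.2.2.2.2.1 hw.2.1 hss

-- `noWitness_periodic`: see the landed `hardyPointSink_noHardyTypeIAncient_periodic` (p165062).

/-- **No witness quiet at large scales** (from `hardyPointSink_cert_largeScale`; lead c6): with the
universal `ε`, no witness has `C + D_osc < ε` on `Q((t₁, x₁), c)` frequently as `c → ∞` at every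
`t₁ < 0` (some centre `x₁`) — every witness is `ε`-singular at spatial infinity, i.e. has only
non-trivial blow-downs. -/
theorem noWitness_largeScaleQuiet : ∃ ε : ℝ≥0∞, 0 < ε ∧ ∀ u p G, IsWitness u p G →
    ∀ x₁ : EuclideanSpace ℝ (Fin 3),
      (∀ t₁ : ℝ, t₁ < 0 → ∃ᶠ c in atTop,
        Literature.Analysis.FluidPDE.cknC c (t₁, x₁) u +
          Literature.Analysis.FluidPDE.cknDOsc c (t₁, x₁) p < ε) → False := by
  obtain ⟨ε, hε, h⟩ := hardyPointSink_cert_largeScale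
  refine ⟨ε, hε, fun u p G hw x₁ hq => ?_⟩
  obtain ⟨-, -, hsw, hG, hne, hI, -⟩ := hw
  exact hne (h u p G hsw hG hI x₁ hq)


/-! ### Cycle 2 (lead c6): the TRACELESS λ-DSS LIOUVILLE certificate chain

Under the Hardy clause the crux's named enemy — a backward `λ`-DSS Type-I blow-up — is
traceless (`hardyPointSink_cert_dssTraceless`). The chain below shows that in the classical,
far-field-`C³` class (isolated singularity at the space–time origin; pressure with the Type-I
decay `|p| ≤ C₁/(|x| + √(−t))²`) a `λ`-DSS solution with ONE Hardy-finite slice vanishes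
identically, for EVERY `λ > 1` — the Type-I DSS Liouville wall
(`Literature.Analysis.FluidPDE.TypeIDSSLiouville`, open for general `λ`; Chae–Wolf 2017 Thm 1.3
only for `λ` near `1`) restricted to Hardy-bounded = traceless solutions. Composition
`hardyPointSink_cert_tracelessDSSLiouville` is kernel-checked from the five stubs `tdss_*`:
Hardy + covariance ⇒ `L²(B_ρ)`-mass → 0 along `s_j = t₀/λ^{2j} ↑ 0` (A); uniform Lipschitz
bound of the test pairings from the equation + Type-I decay of `u` and `p` ⇒ weak vanishing at
the top time (B); Escauriaza–Seregin–Šverák backward uniqueness beyond the far field + unique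
continuation, as packaged for classical solutions in the tree
(`IsClassicalNSSolutionOn.curl_eq_zero_of_farField_of_tendsto`) ⇒ `curl u ≡ 0` near the top
time (C); DSS covariance of the curl ⇒ at all times (D); curl- and div-free slices with Type-I
decay vanish (`eq_of_curl_eq_zero_of_isDivFree_of_bounded`) (E). -/

/-- **Stub (A) `hardyPointSink_tdss_traceless` (PDE-free).** A `λ`-DSS field
(`nsRescale λ u = u`: `λ u(λ²t, λx) = u(t,x)`) with one Hardy-finite measurable slice `u(t₀)`,
`t₀ < 0`, has `∫_{B(0,ρ)} |u(t₀/λ^{2j})|² → 0` for every `ρ > 0`: iterating the covariance,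
`u(t₀/λ^{2j}, y) = λ^j u(t₀, λ^j y)`, and `ρ (λ^jρ)⁻¹ ∫_{B(0,λ^jρ)} |u(t₀)|² → 0` by the Hardy
bound at `t₀` (`tendsto_scaledL2_ball_of_hardy`, `scaledL2_nsZoom`). [folklore] -/
theorem hardyPointSink_tdss_traceless :
    ∀ (u : ℝ → EuclideanSpace ℝ (Fin 3) → EuclideanSpace ℝ (Fin 3)) (c t₀ : ℝ) (Kh : ℝ≥0),
      1 < c → t₀ < 0 → Literature.Analysis.FluidPDE.IsDiscretelySelfSimilar c u →
      AEStronglyMeasurable (u t₀) volume →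
      (∫⁻ x, ‖u t₀ x‖ₑ ^ 2 / ‖x‖ₑ ≤ Kh) →
      ∀ ρ : ℝ, 0 < ρ → Tendsto (fun j : ℕ => ∫⁻ y in Metric.ball (0 : EuclideanSpace ℝ (Fin 3)) ρ,
        ‖u (t₀ / c ^ (2 * j)) y‖ₑ ^ 2) atTop (𝓝 0) := by
  sorry

/-- **Stub (B) `hardyPointSink_tdss_weakTopVanishing`.** For a classical solution `(u, p)` on
`(−∞, 0)` with the Type-I decay `|u| ≤ C₀/(|x| + √(−t))`, `|p| ≤ C₁/(|x| + √(−t))²`, the test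
pairings `g_φ(t) = ∫ ⟪u(t), φ⟫` are uniformly Lipschitz on `(−1, 0)` (`g_φ' = ∫ ⟪∂ₜu, φ⟫ =
∫ ⟪u, Δφ⟫ + ∫ u ⊗ u : ∇φ + ∫ p div φ`, each bounded via `∫_K |x|⁻¹, ∫_K |x|⁻² < ∞`), hence
converge as `t ↑ 0`; if the `L²(B_ρ)`-masses vanish along SOME sequence `s_j ↑ 0`, the limits are
`0`: `u(t) ⇀ 0` weakly as `t ↑ 0`. [folklore] -/
theorem hardyPointSink_tdss_weakTopVanishing :
    ∀ (u : ℝ → EuclideanSpace ℝ (Fin 3) → EuclideanSpace ℝ (Fin 3))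
      (p : ℝ → EuclideanSpace ℝ (Fin 3) → ℝ) (C₀ C₁ : ℝ) (s : ℕ → ℝ),
      Literature.Analysis.FluidPDE.IsClassicalNSSolutionOn (Iio 0) 1 0 u p →
      Literature.Analysis.FluidPDE.HasTypeIDecay C₀ u →
      (∀ t < 0, ∀ x : EuclideanSpace ℝ (Fin 3), |p t x| ≤ C₁ / (‖x‖ + Real.sqrt (-t)) ^ 2) →
      (∀ j, s j < 0) → Tendsto s atTop (𝓝 0) →
      (∀ ρ : ℝ, 0 < ρ → Tendsto (fun j : ℕ => ∫⁻ y in Metric.ball (0 : EuclideanSpace ℝ (Fin 3)) ρ,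
        ‖u (s j) y‖ₑ ^ 2) atTop (𝓝 0)) →
      ∀ φ : EuclideanSpace ℝ (Fin 3) → EuclideanSpace ℝ (Fin 3),
        Literature.Analysis.FunctionSpaces.IsTestFunctionOn
          (⊤ : Opens (EuclideanSpace ℝ (Fin 3))) φ →
        Tendsto (fun t => ∫ x, ⟪u t x, φ x⟫) (𝓝[<] 0) (𝓝 0) := by
  sorry

/-- **Stub (C) `hardyPointSink_tdss_curlZeroNearTop`.** A classical solution on `(−∞, 0)` with
spatial derivatives of order `≤ 3` bounded on the far field `(−δ, 0) × {|x| > R}` and slices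
tending weakly to zero as `t ↑ 0` has `curl u ≡ 0` on `(−δ, 0) × ℝ³`: time-translate by `δ + 1`
(`IsClassicalNSSolutionOn.comp_add_right`) and apply the tree's ESS/GKP packaging
`IsClassicalNSSolutionOn.curl_eq_zero_of_farField_of_tendsto` (backward uniqueness in half-spaces
beyond the far field, then unique continuation inwards).
[cite: EscauriazaSereginSverak2003, Thm. 4.1 and Thm. 5.1] -/
theorem hardyPointSink_tdss_curlZeroNearTop :
    ∀ (u : ℝ → EuclideanSpace ℝ (Fin 3) → EuclideanSpace ℝ (Fin 3))
      (p : ℝ → EuclideanSpace ℝ (Fin 3) → ℝ) (R K δ : ℝ), 0 ≤ R → 0 < δ →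
      Literature.Analysis.FluidPDE.IsClassicalNSSolutionOn (Iio 0) 1 0 u p →
      (∀ n ≤ 3, ∀ w ∈ Ioo (-δ) 0 ×ˢ (Metric.closedBall (0 : EuclideanSpace ℝ (Fin 3)) R)ᶜ,
        ‖iteratedFDeriv ℝ n (u w.1) w.2‖ ≤ K) →
      (∀ φ : EuclideanSpace ℝ (Fin 3) → EuclideanSpace ℝ (Fin 3),
        Literature.Analysis.FunctionSpaces.IsTestFunctionOn
          (⊤ : Opens (EuclideanSpace ℝ (Fin 3))) φ →
        Tendsto (fun t => ∫ x, ⟪u t x, φ x⟫) (𝓝[<] 0) (𝓝 0)) →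
      ∀ t ∈ Ioo (-δ) 0, ∀ x : EuclideanSpace ℝ (Fin 3),
        Literature.Analysis.FluidPDE.curl (u t) x = 0 := by
  sorry

/-- **Stub (D) `hardyPointSink_tdss_curlZeroAllTimes` (PDE-free).** For a `λ`-DSS field with
differentiable slices, `u(t, x) = λ⁻ʲ u(t/λ^{2j}, x/λ^j)`, so `curl u(t) = λ^{-2j} (curl
u(t/λ^{2j}))(·/λ^j)`; if the curl vanishes at all times in `(−δ, 0)` it vanishes at every
`t < 0` (take `j` with `t/λ^{2j} ∈ (−δ, 0)`). [folklore] -/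
theorem hardyPointSink_tdss_curlZeroAllTimes :
    ∀ (u : ℝ → EuclideanSpace ℝ (Fin 3) → EuclideanSpace ℝ (Fin 3)) (c δ : ℝ), 1 < c → 0 < δ →
      Literature.Analysis.FluidPDE.IsDiscretelySelfSimilar c u →
      (∀ t < 0, Differentiable ℝ (u t)) →
      (∀ t ∈ Ioo (-δ) 0, ∀ x : EuclideanSpace ℝ (Fin 3),
        Literature.Analysis.FluidPDE.curl (u t) x = 0) →
      ∀ t < 0, ∀ x : EuclideanSpace ℝ (Fin 3), Literature.Analysis.FluidPDE.curl (u t) x = 0 := by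
  sorry

/-- **Stub (E) `hardyPointSink_tdss_liouvilleSlice`.** A `C²` curl-free, divergence-free field
on `ℝ³` with `‖V x‖ ≤ C/(‖x‖ + a)`, `a > 0`, vanishes: it is bounded (by `C/a`), hence constant
(`eq_of_curl_eq_zero_of_isDivFree_of_bounded`, KNSS 2009 Lemma 3.1), and decays.
[cite: KochNadirashviliSereginSverak2009, Lemma 3.1] -/
theorem hardyPointSink_tdss_liouvilleSlice :
    ∀ (V : EuclideanSpace ℝ (Fin 3) → EuclideanSpace ℝ (Fin 3)) (C a : ℝ), 0 < a →
      ContDiff ℝ 2 V → (∀ x, Literature.Analysis.FluidPDE.curl V x = 0) →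
      Literature.Analysis.FluidPDE.VectorCalculus.IsDivFree V →
      (∀ x, ‖V x‖ ≤ C / (‖x‖ + a)) → ∀ x, V x = 0 := by
  sorry

/-- `t₀/λ^{2j} ↑ 0` strictly from below for `t₀ < 0`, `λ > 1`. [folklore] -/
theorem hardyPointSink_tdss_seq (c t₀ : ℝ) (hc : 1 < c) (ht₀ : t₀ < 0) :
    (∀ j : ℕ, t₀ / c ^ (2 * j) < 0) ∧ Tendsto (fun j : ℕ => t₀ / c ^ (2 * j)) atTop (𝓝 0) := by
  have hc0 : 0 < c := one_pos.trans hc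
  refine ⟨fun j => div_neg_of_neg_of_pos ht₀ (pow_pos hc0 _), ?_⟩
  have h1 : Tendsto (fun j : ℕ => c ^ (2 * j)) atTop atTop := by
    have h := tendsto_pow_atTop_atTop_of_one_lt (one_lt_pow₀ hc two_ne_zero)
    refine h.congr fun j => ?_
    rw [pow_mul]
  simpa using tendsto_const_nhds.div_atTop h1

/-- **Certificate `hardyPointSink_cert_tracelessDSSLiouville` (the Type-I λ-DSS Liouville wall
holds for EVERY `λ > 1` under one Hardy-finite slice; composition of the stubs (A)–(E), no
`sorry` of its own).** Let `(u, p)` be a classical solution of Navier–Stokes (`ν = 1`, no force)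
on `(−∞, 0) × ℝ³`, `λ`-discretely self-similar about the space–time origin (`λ > 1` ARBITRARY),
with the Type-I decay `‖u(t,x)‖ ≤ C₀/(‖x‖ + √(−t))` and `|p(t,x)| ≤ C₁/(‖x‖ + √(−t))²`, regular
off the origin up to the blow-up time in the sense that the spatial derivatives of order `≤ 3`
are bounded on a far field `(−δ, 0) × {|x| > R}`, and suppose ONE slice `u(t₀)`, `t₀ < 0`, has
finite Hardy energy about the origin, `∫ |u(t₀,x)|²/|x| dx < ∞` (as every slice of a witness of
the crux does). Then `u ≡ 0` on `(−∞, 0) × ℝ³`. So the crux's named enemy (a backward λ-DSS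
blow-up with an isolated singularity, λ outside Chae–Wolf's window) does not exist under the
Hardy clause, for any `λ`; what the Hardy clause cannot yet exclude are non-DSS ancient
solutions and DSS blow-ups whose final-time singular set is a `55°`-dense `H¹`-null set of rays.
[cite: EscauriazaSereginSverak2003, Thm. 4.1 and Thm. 5.1] -/
theorem hardyPointSink_cert_tracelessDSSLiouville :
    ∀ (u : ℝ → EuclideanSpace ℝ (Fin 3) → EuclideanSpace ℝ (Fin 3))
      (p : ℝ → EuclideanSpace ℝ (Fin 3) → ℝ) (c C₀ C₁ R K δ t₀ : ℝ) (Kh : ℝ≥0),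
      1 < c → 0 ≤ R → 0 < δ → t₀ < 0 →
      Literature.Analysis.FluidPDE.IsClassicalNSSolutionOn (Iio 0) 1 0 u p →
      Literature.Analysis.FluidPDE.IsDiscretelySelfSimilar c u →
      Literature.Analysis.FluidPDE.HasTypeIDecay C₀ u →
      (∀ t < 0, ∀ x : EuclideanSpace ℝ (Fin 3), |p t x| ≤ C₁ / (‖x‖ + Real.sqrt (-t)) ^ 2) →
      (∀ n ≤ 3, ∀ w ∈ Ioo (-δ) 0 ×ˢ (Metric.closedBall (0 : EuclideanSpace ℝ (Fin 3)) R)ᶜ,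
        ‖iteratedFDeriv ℝ n (u w.1) w.2‖ ≤ K) →
      (∫⁻ x, ‖u t₀ x‖ₑ ^ 2 / ‖x‖ₑ ≤ Kh) →
      ∀ t < 0, ∀ x : EuclideanSpace ℝ (Fin 3), u t x = 0 := by
  intro u p c C₀ C₁ R K δ t₀ Kh hc hR hδ ht₀ hcl hdss hdec hp hK hH t ht x
  have hsm : ∀ s : ℝ, s < 0 → ContDiff ℝ 2 (u s) := fun s hs =>
    (hcl.contDiff_velocity (Set.mem_Iio.2 hs)).of_le (by norm_cast)
  -- (A) traceless along `s_j = t₀ / λ^{2j}`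
  have hmeas : AEStronglyMeasurable (u t₀) volume :=
    (hsm t₀ ht₀).continuous.aestronglyMeasurable
  have hA := hardyPointSink_tdss_traceless u c t₀ Kh hc ht₀ hdss hmeas hH
  obtain ⟨hsneg, hs0⟩ := hardyPointSink_tdss_seq c t₀ hc ht₀
  -- (B) weak vanishing at the top time
  have hB := hardyPointSink_tdss_weakTopVanishing u p C₀ C₁ (fun j : ℕ => t₀ / c ^ (2 * j))
    hcl hdec hp hsneg hs0 hA
  -- (C) curl vanishes near the top time, (D) at all times
  have hC := hardyPointSink_tdss_curlZeroNearTop u p R K δ hR hδ hcl hK hB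
  have hdiff : ∀ s : ℝ, s < 0 → Differentiable ℝ (u s) := fun s hs =>
    (hsm s hs).differentiable (by norm_cast)
  have hD := hardyPointSink_tdss_curlZeroAllTimes u c δ hc hδ hdss hdiff hC
  -- (E) Liouville on the slice `t`
  exact hardyPointSink_tdss_liouvilleSlice (u t) C₀ (Real.sqrt (-t)) (Real.sqrt_pos.2 (by linarith))
    (hsm t ht) (hD t ht) (hcl.divFree t (Set.mem_Iio.2 ht)) (hdec t ht) x

end Summit.NavierStokesRegularity.NavierStokesRegularity.Cruxes.NoHardyTypeIAncient.Birth
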